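import Literature.Probability.RandomPlanarGeometry.SLELoopRestriction
import Literature.Probability.RandomPlanarGeometry.SLELoopMassIdentity
import HarnessLib

/-!
# [Lawler2009] Prop. 2.1: reduction to the loop-mass identity along the SLE flow and to [LSW] Thm. 6.5

Proof file (theorems only; no definition, no named fact) for the named fact
`Literature.Probability.RandomPlanarGeometry.Lawler2009_prop21` (`SLELoopRestriction`):

* G. F. Lawler, *Partition functions, loop measure, and versions of SLE*, J. Stat. Phys. **134**
  (2009) 813–837 (**[Lawler2009]**), §2.2, Prop. 2.1 (p. 7 of the offprint): for `κ ≤ 4`,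
  `E[1{γ ⊂ D} Ψ_{∞,D}(γ)^{c/2}] = Φ'_D(0)^b`, `Ψ_{∞,D}(γ) = exp Λ(γ, ℍ ∖ D; ℍ)`;
  "This was proved in [7] (= [LSW]) for `κ ≤ 8/3` (for which `c ≤ 0`) … For `8/3 < κ ≤ 4`
  (`c > 0`), `M_t` is not bounded and the Girsanov argument is the only way I know how to prove
  this."

The printed route has three inputs, which this file separates and glues (all glue PROVED):

1. **The loop-mass identity along the flow** ([Lawler2009] §2.2, display before (4): "If
   `K₁ = γ_t` is a curve in `D` with `γ(0+) = 0`, with corresponding conformal maps `g_t` …,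
   then `Λ(γ_t, ℍ ∖ D; ℍ) = −(a/6) ∫₀ᵗ SΦ_s(U_s) ds` … If we had chosen the parametrization as
   in (1), the `a` would be replaced with `2`"; it is Lawler–Werner, *The Brownian loop soup*
   (2004), Thm. 12 / Lawler (2005) Prop. 5.34 with Prop. 5.22, `μ^bub[hit A] = −SΦ_A(0)/6`).
   In the tree's half-plane-capacity parametrisation (`ġ = 2/(g − √κ B)`) and vocabulary
   (`starBubbleMass (A_s − W_s) = −SΦ_{g_s(A)}(W_s)/6`, `SLEBubblesSchwarzianMass`) it reads
   `Λ(γ[0, ∞), A; ℍ) = 2 ∫₀^∞ starBubbleMass (slidHull W A s) ds` on `{γ ∩ A = ∅}`; it is the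
   hypothesis `hΛ` below (its proof needs the conformal invariance of the loop measure,
   the named fact `loopMass_conformalImage` of `BrownianLoopMeasure`, not yet discharged).
2. **[LSW] Thm. 6.5 for `0 < κ ≤ 8/3`** — a theorem of the tree (`thm65_printed`,
   `SLEBubblesThm65Kappa`): `∫⁻ 1{γ ∩ A = ∅} 𝒫(λ_κ ∫₀^∞ m) = Φ_A′(0)^{α_κ}`, `𝒫(x) = e^{−x}`.
3. **The same expectation identity for `8/3 < κ ≤ 4`** (unbounded local martingale, Girsanov;
   [Lawler2009] Prop. 2.1 proper) — hypothesis `hgt` below, in exponential form (for `κ > 8/3`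
   the intensity `λ_κ < 0` and the tree's `sleBubbleIntensity κ = ofReal λ_κ` vanishes, so the
   `𝒫`-form of item 2 cannot express it).

Results:

* `centralCharge_div_two_mul_two` etc. — the constants: `c = (8 − 3κ)(κ − 6)/(2κ) = −λ_κ`,
  `b = (6 − κ)/(2κ) = α_κ` (`sleBubbleIntensityReal`, `sleBubbleExponent`), `λ_κ ≥ 0` iff
  `κ ≤ 8/3`;
* `Lawler2009_prop21_of_core`, `setLIntegral_exp_loopMass_eq_of_le_of_core` — **Prop. 2.1 from
  the analytic core**: with the loop-mass identity PROVED along the flow from its inputs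
  (`ae_loopMass_range_sleTrace_eq`, `SLELoopMassIdentity`), Prop. 2.1 for `κ ≤ 8/3` follows from
  `hX : loopMass_conformalImage` (Lawler–Werner 2004 Prop. 6) and Lawler (2005) Prop. 5.30 on
  Loewner hulls (`h530a`, `h530b`) alone, and for all `κ ≤ 4` from these and `hgt`;
* `ae_loopMass_range_sleTrace_lt_top` — for `0 < κ ≤ 4`, almost surely, on `{γ ∩ A = ∅}` the
  loop mass `Λ(γ[0,∞), A; ℍ)` is finite (the trace is continuous and transient, so its range is
  closed — `Loewner.isClosed_range_of_tendsto_norm_atTop` — and at positive distance from the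
  compact `A`; then `loopMass_lt_top_holds`), so the `toReal` in the statement meets no junk;
* `Lawler2009_prop21_eightThirds` — **the case `κ = 8/3` holds outright** (`c = 0`: it is
  [LSW] Thm. 6.1, `sle_restriction_eightThirds_holds`);
* `setLIntegral_exp_loopMass_eq_of_le (κ ≤ 8/3)` — **Prop. 2.1 for `0 < κ ≤ 8/3` from the
  loop-mass identity `hΛ` alone**, by `thm65_printed`;
* `Lawler2009_prop21_of_loopMass_eq` — **Prop. 2.1 for all `0 < κ ≤ 4` from `hΛ` (all `κ ≤ 4`)
  and `hgt` (`8/3 < κ ≤ 4`)**.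

## References

* [Lawler2009] §2.2 Prop. 2.1, eqs. (3)–(4) (pp. 5–7); §4 (17)–(21) (normalisations).
* [LSW] G. F. Lawler, O. Schramm, W. Werner, JAMS 16 (2003), Thm. 6.5, §7.1 (7.2).
  [LawlerSchrammWerner2003Restriction]
* G. F. Lawler, *Conformally Invariant Processes in the Plane* (2005), §5.5 Prop. 5.22,
  §5.6 Remark 5.28 and Prop. 5.30, §5.7 Def. 5.32 and Prop. 5.34. [Lawler2005]
* [LW04] G. F. Lawler, W. Werner, PTRF 128 (2004), Prop. 6, Prop. 11, Thm. 12. [LawlerWerner2004]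
-/

noncomputable section

open Set Filter Topology MeasureTheory Metric
open UpperHalfPlane (upperHalfPlaneSet isOpen_upperHalfPlaneSet)
open Literature.Probability.Process (preWienerMeasure)
open scoped NNReal ENNReal

namespace Literature.Probability.RandomPlanarGeometry

open Loewner

/-! ### The constants of [Lawler2009] (1) versus [LSW] (5.2)–(5.3) -/

/-- `c/2 · 2 = −λ_κ`: the central charge `c = (8 − 3κ)(κ − 6)/(2κ)` of [Lawler2009] (1) is minus
the bubble intensity `λ_κ = (8 − 3κ)(6 − κ)/(2κ)` of [LSW] (5.3). [cite: Lawler2009, §2.1 (1)] -/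
theorem centralCharge_eq_neg_sleBubbleIntensityReal (κ : ℝ≥0) :
    (8 - 3 * (κ : ℝ)) * ((κ : ℝ) - 6) / (2 * (κ : ℝ)) = -sleBubbleIntensityReal κ := by
  unfold sleBubbleIntensityReal
  ring

/-- `b = (6 − κ)/(2κ)` of [Lawler2009] (1) is `α_κ` of [LSW] (5.2). [cite: Lawler2009, §2.1 (1)] -/
theorem boundaryExponent_eq_sleBubbleExponent (κ : ℝ≥0) :
    (6 - (κ : ℝ)) / (2 * (κ : ℝ)) = sleBubbleExponent κ := rfl

/-- `λ_κ ≥ 0` for `κ ≤ 8/3` ("for which `c ≤ 0`"). [cite: Lawler2009, Prop. 2.1 (remark)] -/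
theorem sleBubbleIntensityReal_nonneg {κ : ℝ≥0} (h : κ ≤ 8 / 3) : 0 ≤ sleBubbleIntensityReal κ := by
  have h' : (κ : ℝ) ≤ 8 / 3 := by exact_mod_cast h
  have h0 : (0 : ℝ) ≤ κ := κ.2
  unfold sleBubbleIntensityReal
  have h1 : (0 : ℝ) ≤ 8 - 3 * κ := by linarith
  have h2 : (0 : ℝ) ≤ 6 - κ := by linarith
  positivity

/-- `λ_κ < 0` for `8/3 < κ ≤ 4` ("`c > 0`"). [cite: Lawler2009, Prop. 2.1 (remark)] -/
theorem sleBubbleIntensityReal_neg {κ : ℝ≥0} (h : 8 / 3 < κ) (h4 : κ ≤ 4) : sleBubbleIntensityReal κ < 0 := by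
  have h' : (8 : ℝ) / 3 < κ := by exact_mod_cast h
  have h4' : (κ : ℝ) ≤ 4 := by exact_mod_cast h4
  unfold sleBubbleIntensityReal
  have h1 : 8 - 3 * (κ : ℝ) < 0 := by linarith
  have h2 : (0 : ℝ) < 6 - κ := by linarith
  have h3 : (0 : ℝ) < 2 * κ := by linarith
  exact div_neg_of_neg_of_pos (mul_neg_of_neg_of_pos h1 h2) h3

/-! ### `Λ(γ[0,∞), A; ℍ) < ∞` on `{γ ∩ A = ∅}` -/

/-- **`Λ(γ[0,∞), A; ℍ) < ∞` almost surely on `{γ[0,∞) ∩ A = ∅}`** for the SLE_κ trace,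
`0 < κ ≤ 4`, and `A ∈ 𝒬*`: the trace is continuous and transient (Rohde–Schramm), so its range
is closed and at positive distance from the compact hull `A`, and [Lawler2009] §2.2 ("If `K₁` is
bounded, `dist(K₁, K₂) > 0`, and `∂D` is nonpolar, then `Λ(K₁, K₂; D) < ∞`",
`loopMass_lt_top_holds`) applies. [cite: Lawler2009, §2.2 (finiteness of Λ)] -/
theorem ae_loopMass_range_sleTrace_lt_top {κ : ℝ≥0} (hκ0 : 0 < κ) (hκ4 : κ ≤ 4) {A : Set ℂ}
    (hA : IsStarHull A) :
    ∀ᵐ ω ∂preWienerMeasure, Disjoint (range (sleTrace κ ω)) A →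
      loopMass upperHalfPlaneSet (range (sleTrace κ ω)) A < ∞ := by
  obtain ⟨-, -, htrans⟩ := sle_trace_facts_of_le_four hκ0 hκ4
  filter_upwards [htrans] with ω hω hdisj
  have hcl : IsClosed (range (sleTrace κ ω)) :=
    Loewner.isClosed_range_of_tendsto_norm_atTop (continuous_sleTrace κ ω) hω
  obtain ⟨δ, hδ, hsep⟩ := Loewner.exists_pos_forall_le_dist hA.isBoundedHull.isCompact hcl hdisj.symm
  rw [loopMass_comm]
  exact loopMass_lt_top_holds isOpen_upperHalfPlaneSet Loewner.exists_ball_disjoint_upperHalfPlaneSet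
    hA.isBoundedHull.1 ⟨δ, hδ, hsep⟩

/-- The event `{γ[0,∞) ∩ A = ∅}` is null-measurable for `0 < κ ≤ 4` (continuous trace with a.e.
measurable marginals, closed `A`). [folklore] -/
theorem nullMeasurableSet_disjoint_range_sleTrace {κ : ℝ≥0} (hκ0 : 0 < κ) (hκ4 : κ ≤ 4)
    {A : Set ℂ} (hA : IsStarHull A) :
    NullMeasurableSet {ω | Disjoint (range (sleTrace κ ω)) A} preWienerMeasure := by
  obtain ⟨hgen, -, -⟩ := sle_trace_facts_of_le_four hκ0 hκ4
  exact nullMeasurableSet_disjoint_range (fun ω ↦ continuous_sleTrace _ ω)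
    (fun t ↦ aemeasurable_sleTrace_holds hgen t) hA.isBoundedHull.isClosed

/-! ### `κ = 8/3`: Prop. 2.1 is [LSW] Thm. 6.1 -/

/-- **[Lawler2009] Prop. 2.1 at `κ = 8/3` holds**: `c = 0`, the weight is `1`, `b = 5/8`, and the
statement is [LSW] Thm. 6.1 (`sle_restriction_eightThirds_holds`).
[cite: Lawler2009, Prop. 2.1 ("This was proved in [7] for κ ≤ 8/3")] -/
theorem Lawler2009_prop21_eightThirds {A : Set ℂ} (hA : IsStarHull A)
    {Φ : ConformalEquiv (upperHalfPlaneSet \ A) upperHalfPlaneSet} (hΦ : IsRestrictionMap A Φ)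
    {d : ℝ} (hd : HasRestrictionDeriv A Φ d) :
    ∫⁻ ω in {ω | Disjoint (range (sleTrace ((8 : ℝ≥0) / 3) ω)) A},
        ENNReal.ofReal (Real.exp
          ((8 - 3 * (((8 : ℝ≥0) / 3 : ℝ≥0) : ℝ)) * ((((8 : ℝ≥0) / 3 : ℝ≥0) : ℝ) - 6) /
              (2 * (((8 : ℝ≥0) / 3 : ℝ≥0) : ℝ)) / 2 *
            (loopMass upperHalfPlaneSet (range (sleTrace ((8 : ℝ≥0) / 3) ω)) A).toReal))
      ∂preWienerMeasure =
      ENNReal.ofReal (d ^ ((6 - (((8 : ℝ≥0) / 3 : ℝ≥0) : ℝ)) / (2 * (((8 : ℝ≥0) / 3 : ℝ≥0) : ℝ)))) := by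
  have hc : (8 - 3 * (((8 : ℝ≥0) / 3 : ℝ≥0) : ℝ)) = 0 := by push_cast; ring
  have hb : (6 - (((8 : ℝ≥0) / 3 : ℝ≥0) : ℝ)) / (2 * (((8 : ℝ≥0) / 3 : ℝ≥0) : ℝ)) = (5 : ℝ) / 8 := by
    push_cast; norm_num
  simp only [hc, zero_mul, zero_div, Real.exp_zero, ENNReal.ofReal_one, lintegral_one,
    Measure.restrict_apply MeasurableSet.univ, univ_inter, hb]
  exact sle_restriction_eightThirds_holds hA hΦ hd

/-! ### `0 < κ ≤ 8/3`: Prop. 2.1 from the loop-mass identity and [LSW] Thm. 6.5 -/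

/-- **[Lawler2009] Prop. 2.1 for `0 < κ ≤ 8/3`, from the loop-mass identity along the flow.**
If, almost surely on `{γ[0,∞) ∩ A = ∅}`, `Λ(γ[0,∞), A; ℍ) = 2 ∫₀^∞ m(A_t − W_t) dt`
(`m = starBubbleMass = −SΦ/6`; [Lawler2009] §2.2 "`Λ(γ_t, ℍ ∖ D; ℍ) = −(2/6) ∫₀ᵗ SΦ_s ds`" in
the parametrisation (1)), then `E[1{γ ∩ A = ∅} e^{(c/2) Λ}] = Φ_A′(0)^b`: by [LSW] Thm. 6.5
(`thm65_printed`), since `e^{(c/2)·2∫m} = e^{−λ∫m} = 𝒫(λ ∫ m)` wherever `Λ < ∞`, which holds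
a.s. on the event (`ae_loopMass_range_sleTrace_lt_top`).
[cite: Lawler2009, Prop. 2.1 (κ ≤ 8/3, "proved in [7]")] -/
theorem setLIntegral_exp_loopMass_eq_of_le {κ : ℝ≥0} (hκ0 : 0 < κ) (hκ : κ ≤ 8 / 3)
    {A : Set ℂ} (hA : IsStarHull A)
    (hΛ : ∀ᵐ ω ∂preWienerMeasure, Disjoint (range (sleTrace κ ω)) A →
      loopMass upperHalfPlaneSet (range (sleTrace κ ω)) A =
        2 * ∫⁻ t, ENNReal.ofReal (starBubbleMass (slidHull (sleDriving κ ω) A t)) ∂timeMeasure)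
    {Φ : ConformalEquiv (upperHalfPlaneSet \ A) upperHalfPlaneSet} (hΦ : IsRestrictionMap A Φ)
    {d : ℝ} (hd : HasRestrictionDeriv A Φ d) :
    ∫⁻ ω in {ω | Disjoint (range (sleTrace κ ω)) A},
        ENNReal.ofReal (Real.exp ((8 - 3 * (κ : ℝ)) * ((κ : ℝ) - 6) / (2 * (κ : ℝ)) / 2 *
          (loopMass upperHalfPlaneSet (range (sleTrace κ ω)) A).toReal)) ∂preWienerMeasure =
      ENNReal.ofReal (d ^ ((6 - (κ : ℝ)) / (2 * (κ : ℝ)))) := by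
  have hκ4 : κ ≤ 4 := le_four_of_le_eight_thirds hκ
  have hlam : 0 ≤ sleBubbleIntensityReal κ := sleBubbleIntensityReal_nonneg hκ
  rw [boundaryExponent_eq_sleBubbleExponent, ← thm65_printed hκ0 hκ hA hΦ hd,
    ← lintegral_indicator₀ (nullMeasurableSet_disjoint_range_sleTrace hκ0 hκ4 hA)]
  refine lintegral_congr_ae ?_
  filter_upwards [hΛ, ae_loopMass_range_sleTrace_lt_top hκ0 hκ4 hA] with ω hω hfin
  by_cases hdisj : Disjoint (range (sleTrace κ ω)) A
  · rw [indicator_of_mem (show ω ∈ {ω | Disjoint (range (sleTrace κ ω)) A} from hdisj),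
      indicator_of_mem (show ω ∈ {ω | Disjoint (range (sleTrace κ ω)) A} from hdisj)]
    set I := ∫⁻ t, ENNReal.ofReal (starBubbleMass (slidHull (sleDriving κ ω) A t)) ∂timeMeasure
      with hI
    have hΛeq : loopMass upperHalfPlaneSet (range (sleTrace κ ω)) A = 2 * I := hω hdisj
    have hΛfin : loopMass upperHalfPlaneSet (range (sleTrace κ ω)) A < ∞ := hfin hdisj
    have hIfin : I ≠ ∞ := by
      intro h
      rw [hΛeq, h, ENNReal.mul_top (by norm_num)] at hΛfin
      exact lt_irrefl _ hΛfin
    have hprod : sleBubbleIntensity κ * I ≠ ∞ := ENNReal.mul_ne_top ENNReal.ofReal_ne_top hIfin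
    rw [poissonAvoidance_of_ne_top hprod, ENNReal.toReal_mul, sleBubbleIntensity,
      ENNReal.toReal_ofReal hlam, hΛeq, ENNReal.toReal_mul, ENNReal.toReal_ofNat,
      centralCharge_eq_neg_sleBubbleIntensityReal]
    congr 2
    ring
  · rw [indicator_of_notMem (show ω ∉ {ω | Disjoint (range (sleTrace κ ω)) A} from hdisj),
      indicator_of_notMem (show ω ∉ {ω | Disjoint (range (sleTrace κ ω)) A} from hdisj)]

/-! ### All `0 < κ ≤ 4`: Prop. 2.1 from the loop-mass identity and the identity of §2.2 for `κ > 8/3` -/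

/-- **[Lawler2009] Prop. 2.1 from its two printed inputs.** Assume (i) the loop-mass identity
along the SLE_κ flow for every `0 < κ ≤ 4` and `A ∈ 𝒬*` ([Lawler2009] §2.2, display before (4);
Lawler–Werner 2004 Thm. 12 with [LSW] (7.2)): a.s. on `{γ ∩ A = ∅}`,
`Λ(γ[0,∞), A; ℍ) = 2 ∫₀^∞ starBubbleMass (A_t − W_t) dt`; and (ii) for `8/3 < κ ≤ 4` the
expectation identity `E[1{γ ∩ A = ∅} exp(−λ_κ ∫₀^∞ starBubbleMass (A_t − W_t) dt)] = Φ_A′(0)^{α_κ}`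
(the unbounded case of the martingale `M_t` of (3)–(4), [Lawler2009] Prop. 2.1 by the Girsanov
argument; for `κ ≤ 8/3` this is [LSW] Thm. 6.5, a theorem of the tree). Then
`Lawler2009_prop21` holds. [cite: Lawler2009, Prop. 2.1 (§2.2, eqs. (3)–(4))] -/
theorem Lawler2009_prop21_of_loopMass_eq
    (hΛ : ∀ {κ : ℝ≥0}, 0 < κ → κ ≤ 4 → ∀ {A : Set ℂ}, IsStarHull A →
      ∀ᵐ ω ∂preWienerMeasure, Disjoint (range (sleTrace κ ω)) A →
        loopMass upperHalfPlaneSet (range (sleTrace κ ω)) A =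
          2 * ∫⁻ t, ENNReal.ofReal (starBubbleMass (slidHull (sleDriving κ ω) A t)) ∂timeMeasure)
    (hgt : ∀ {κ : ℝ≥0}, 8 / 3 < κ → κ ≤ 4 → ∀ {A : Set ℂ}, IsStarHull A →
      ∀ {Φ : ConformalEquiv (upperHalfPlaneSet \ A) upperHalfPlaneSet}, IsRestrictionMap A Φ →
        ∀ {d : ℝ}, HasRestrictionDeriv A Φ d →
          ∫⁻ ω in {ω | Disjoint (range (sleTrace κ ω)) A},
              ENNReal.ofReal (Real.exp (-sleBubbleIntensityReal κ *
                (∫⁻ t, ENNReal.ofReal (starBubbleMass (slidHull (sleDriving κ ω) A t))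
                  ∂timeMeasure).toReal)) ∂preWienerMeasure =
            ENNReal.ofReal (d ^ sleBubbleExponent κ)) :
    Lawler2009_prop21 := by
  intro κ hκ0 hκ4' A hA Φ hΦ d hd
  have hκ4 : κ ≤ 4 := by exact_mod_cast hκ4'
  rcases le_or_gt κ (8 / 3) with hle | hlt
  · exact setLIntegral_exp_loopMass_eq_of_le hκ0 hle hA (hΛ hκ0 hκ4 hA) hΦ hd
  · rw [boundaryExponent_eq_sleBubbleExponent, ← hgt hlt hκ4 hA hΦ hd]
    -- both integrands agree a.s. on the event: `(c/2) · (2 I).toReal = −λ · I.toReal`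
    have hnull := nullMeasurableSet_disjoint_range_sleTrace hκ0 hκ4 hA
    rw [← lintegral_indicator₀ hnull, ← lintegral_indicator₀ hnull]
    refine lintegral_congr_ae ?_
    filter_upwards [hΛ hκ0 hκ4 hA] with ω hω
    by_cases hdisj : Disjoint (range (sleTrace κ ω)) A
    · rw [indicator_of_mem (show ω ∈ {ω | Disjoint (range (sleTrace κ ω)) A} from hdisj),
        indicator_of_mem (show ω ∈ {ω | Disjoint (range (sleTrace κ ω)) A} from hdisj),
        hω hdisj, ENNReal.toReal_mul, ENNReal.toReal_ofNat, centralCharge_eq_neg_sleBubbleIntensityReal]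
      congr 2
      ring
    · rw [indicator_of_notMem (show ω ∉ {ω | Disjoint (range (sleTrace κ ω)) A} from hdisj),
        indicator_of_notMem (show ω ∉ {ω | Disjoint (range (sleTrace κ ω)) A} from hdisj)]

/-! ### Prop. 2.1 from the analytic core: conformal invariance of `Λ` and Lawler's Prop. 5.30 -/

/-- **[Lawler2009] Prop. 2.1 for `0 < κ ≤ 8/3` from the analytic core.** With the loop-mass
identity along the flow proved from its inputs (`ae_loopMass_range_sleTrace_eq`), the loop-measure
form `E[1{γ ∩ A = ∅} e^{(c/2) Λ(γ, A; ℍ)}] = Φ_A′(0)^b` follows, for `κ ≤ 8/3`, from [LSW] Thm. 6.5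
(`thm65_printed`, a theorem of the tree) given only the conformal invariance of `Λ`
(`hX : loopMass_conformalImage`, Lawler–Werner 2004 Prop. 6) and Lawler (2005) Prop. 5.30 read on
Loewner hulls (`h530a`: `Λ(K^{Uₙ}_{uₙ}, {r ≤ |z|}; ℍ)/(2uₙ) → 1/r²`; `h530b`:
`Λ(K^{Uₙ}_{uₙ}, B; ℍ)/(2uₙ) → starBubbleMass B`, with Prop. 5.22).
[cite: Lawler2009, Prop. 2.1 (κ ≤ 8/3, "proved in [7]")] -/
theorem setLIntegral_exp_loopMass_eq_of_le_of_core (hX : loopMass_conformalImage)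
    (h530a : ∀ (U : ℕ → ℝ≥0 → ℝ) (u : ℕ → ℝ≥0), (∀ n, Continuous (U n)) → (∀ n, U n 0 = 0) →
      (∀ n, 0 < u n) → Tendsto u atTop (𝓝 0) →
      (∀ ε : ℝ, 0 < ε → ∀ᶠ n in atTop, hull (U n) (u n) ⊆ ball (0 : ℂ) ε) →
      ∀ {r : ℝ}, 0 < r →
        Tendsto (fun n ↦ (loopMass upperHalfPlaneSet (hull (U n) (u n)) {z : ℂ | r ≤ ‖z‖}).toReal /
          (2 * (u n : ℝ))) atTop (𝓝 (1 / r ^ 2)))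
    (h530b : ∀ (U : ℕ → ℝ≥0 → ℝ) (u : ℕ → ℝ≥0), (∀ n, Continuous (U n)) → (∀ n, U n 0 = 0) →
      (∀ n, 0 < u n) → Tendsto u atTop (𝓝 0) →
      (∀ ε : ℝ, 0 < ε → ∀ᶠ n in atTop, hull (U n) (u n) ⊆ ball (0 : ℂ) ε) →
      ∀ {B : Set ℂ}, IsStarHull B →
        Tendsto (fun n ↦ (loopMass upperHalfPlaneSet (hull (U n) (u n)) B).toReal / (2 * (u n : ℝ)))
          atTop (𝓝 (starBubbleMass B)))
    {κ : ℝ≥0} (hκ0 : 0 < κ) (hκ : κ ≤ 8 / 3) {A : Set ℂ} (hA : IsStarHull A)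
    {Φ : ConformalEquiv (upperHalfPlaneSet \ A) upperHalfPlaneSet} (hΦ : IsRestrictionMap A Φ)
    {d : ℝ} (hd : HasRestrictionDeriv A Φ d) :
    ∫⁻ ω in {ω | Disjoint (range (sleTrace κ ω)) A},
        ENNReal.ofReal (Real.exp ((8 - 3 * (κ : ℝ)) * ((κ : ℝ) - 6) / (2 * (κ : ℝ)) / 2 *
          (loopMass upperHalfPlaneSet (range (sleTrace κ ω)) A).toReal)) ∂preWienerMeasure =
      ENNReal.ofReal (d ^ ((6 - (κ : ℝ)) / (2 * (κ : ℝ)))) :=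
  setLIntegral_exp_loopMass_eq_of_le hκ0 hκ hA
    (ae_loopMass_range_sleTrace_eq hX h530a h530b hκ0 (le_four_of_le_eight_thirds hκ) hA) hΦ hd

/-- **[Lawler2009] Prop. 2.1 from the analytic core.** `Lawler2009_prop21` holds GIVEN: the
conformal invariance of the Brownian loop mass `Λ` (`hX : loopMass_conformalImage`, Lawler–Werner
2004 Prop. 6 / Lawler 2005 Prop. 5.27); Lawler (2005) Prop. 5.30 on Loewner hulls in its two
readings `h530a` (total mass `1/r²`) and `h530b` (targets `B ∈ 𝒬*`, Prop. 5.22); and, for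
`8/3 < κ ≤ 4` only, the expectation identity `hgt` of [Lawler2009] §2.2 for the unbounded
martingale `M_t` of (3)–(4) (the Girsanov argument). For `κ ≤ 8/3` the last input is not used
([LSW] Thm. 6.5 is a theorem of the tree). [cite: Lawler2009, Prop. 2.1 (§2.2, eqs. (3)–(4))] -/
theorem Lawler2009_prop21_of_core (hX : loopMass_conformalImage)
    (h530a : ∀ (U : ℕ → ℝ≥0 → ℝ) (u : ℕ → ℝ≥0), (∀ n, Continuous (U n)) → (∀ n, U n 0 = 0) →
      (∀ n, 0 < u n) → Tendsto u atTop (𝓝 0) →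
      (∀ ε : ℝ, 0 < ε → ∀ᶠ n in atTop, hull (U n) (u n) ⊆ ball (0 : ℂ) ε) →
      ∀ {r : ℝ}, 0 < r →
        Tendsto (fun n ↦ (loopMass upperHalfPlaneSet (hull (U n) (u n)) {z : ℂ | r ≤ ‖z‖}).toReal /
          (2 * (u n : ℝ))) atTop (𝓝 (1 / r ^ 2)))
    (h530b : ∀ (U : ℕ → ℝ≥0 → ℝ) (u : ℕ → ℝ≥0), (∀ n, Continuous (U n)) → (∀ n, U n 0 = 0) →
      (∀ n, 0 < u n) → Tendsto u atTop (𝓝 0) →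
      (∀ ε : ℝ, 0 < ε → ∀ᶠ n in atTop, hull (U n) (u n) ⊆ ball (0 : ℂ) ε) →
      ∀ {B : Set ℂ}, IsStarHull B →
        Tendsto (fun n ↦ (loopMass upperHalfPlaneSet (hull (U n) (u n)) B).toReal / (2 * (u n : ℝ)))
          atTop (𝓝 (starBubbleMass B)))
    (hgt : ∀ {κ : ℝ≥0}, 8 / 3 < κ → κ ≤ 4 → ∀ {A : Set ℂ}, IsStarHull A →
      ∀ {Φ : ConformalEquiv (upperHalfPlaneSet \ A) upperHalfPlaneSet}, IsRestrictionMap A Φ →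
        ∀ {d : ℝ}, HasRestrictionDeriv A Φ d →
          ∫⁻ ω in {ω | Disjoint (range (sleTrace κ ω)) A},
              ENNReal.ofReal (Real.exp (-sleBubbleIntensityReal κ *
                (∫⁻ t, ENNReal.ofReal (starBubbleMass (slidHull (sleDriving κ ω) A t))
                  ∂timeMeasure).toReal)) ∂preWienerMeasure =
            ENNReal.ofReal (d ^ sleBubbleExponent κ)) :
    Lawler2009_prop21 :=
  Lawler2009_prop21_of_loopMass_eq
    (fun hκ0 hκ4 _ hA ↦ ae_loopMass_range_sleTrace_eq hX h530a h530b hκ0 hκ4 hA) hgt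

end Literature.Probability.RandomPlanarGeometry

end
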